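import Summits.AtomisticToContinuum.Crystallization.Theses.HullExactificationCascade
import Summits.AtomisticToContinuum.Crystallization.Theorems.HullExactificationCascadeRobustBarlowTemplateDefs
import Summits.AtomisticToContinuum.Crystallization.Theorems.HullExactificationCascadeRobustBarlowTemplateStubReciprocity
import Summits.AtomisticToContinuum.Crystallization.Theorems.HullExactificationCascadeRobustBarlowTemplateStubExhaust
import Summits.AtomisticToContinuum.Crystallization.Theorems.HullExactificationCascadeRobustBarlowTemplateDevelopCharts
import Summits.AtomisticToContinuum.Crystallization.Theorems.HullExactificationCascadeRobustBarlowTemplateTransportDefs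
import Summits.AtomisticToContinuum.Crystallization.Theorems.HullExactificationCascadeRobustBarlowTemplateDevelopCovering
import Summits.AtomisticToContinuum.Crystallization.Theorems.HullExactificationCascadeRobustBarlowTemplateDevelopLocSim
import Summits.AtomisticToContinuum.Crystallization.Theorems.HullExactificationCascadeRobustBarlowTemplateDevelopZChart
import Summits.AtomisticToContinuum.Crystallization.Theorems.HullExactificationCascadeRobustBarlowTemplateDevelopTransfer
import Summits.AtomisticToContinuum.Crystallization.Theorems.HullExactificationCascadeRobustBarlowTemplateCoveringCriterion
import Summits.AtomisticToContinuum.Crystallization.Theorems.HullExactificationCascadeRobustBarlowTemplateDevelopTransport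
import Summits.AtomisticToContinuum.Crystallization.Theorems.HullExactificationCascadeRobustBarlowTemplateDevelopInjective

/-!
# Birth skeleton — crux `RobustBarlowTemplate` (item `stmt-AtomisticToContinuum-12088`) — COMPLETE (lead c3, 2026-08-17)

Route `route-AtomisticToContinuum-HullExactificationCascade` (crux C, rank 4; the decl is shared
with route `DisclinationRation`). Published as `Cruxes/RobustBarlowTemplate/Lines/birth.lean`.
ALL registered stubs are LANDED under `Theorems/HullExactificationCascadeRobustBarlowTemplate*.lean`
(namespace `…Theorems.HullExactificationCascadeRobustBarlowTemplate`); this file has NO `sorry`; the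
closing Theorems file is `Theorems/HullExactificationCascadeRobustBarlowTemplate.lean`
(`Summit.AtomisticToContinuum.Crystallization.Theorems.robustBarlowTemplate_proof`).

The crux: for every `δ > 0`, every nonempty `δ`-separated `S ⊆ ℝ³` all of whose points are
`1/20`-good (first shell, rescaled and recentred, `1/20`-matched after a linear isometry to the FCC
or the HCP kissing pattern) is the bijective image of the ideal Barlow stacking
`barlowStacking 1 √(2/3) s` of some Hägg sequence `s` under a map `1/20`-close to a similarity on
every unit cluster.

## The line, as run

* `stub_reciprocity` (p149678) — shells are reciprocal with comparable scales (60° covering bound).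
* `stub_develop` := `develop_transport` (p165017: integer charts `develop_charts`/`develop_zchart`,
  the transfer lemma AT TOLERANCE 1/20 `develop_transfer` — metric on the label spectrum {18,36,54},
  combinatorial for 48 —, then the port of the 9227 transport system to the scale-relative shell
  relation, 20 files) ∘ `develop_covering` (p152042) + `develop_locsim` (p152179: pattern
  rigidity) + `develop_injective` (p162600: the piecewise-affine extension of the development over
  the refined tetrahedral–octahedral honeycomb — explicit per-slab skew coordinates, octahedra
  quartered along a diagonal — is continuous, open, injective on `1/6`-balls and uniformly
  co-Lipschitz thanks to the hard floor `δ`, hence a covering map of the simply connected `ℝ³`, hence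
  bijective; per-cell linear deviation ≤ 12/19·l < l).
* `stub_exhaust` (p149628) — a nonempty shell-closed subset is everything (descent by δ/50).
* `composition` and `RobustBarlowTemplate_of` — the crux BY NAME.

Recorded risk ("tolerance 1/20 too generous for unambiguous propagation") retired by
`develop_transfer`: √2/√3 labels transfer metrically at 1/20 (1.514 < 1.554), the HCP-specific
√(8/3) label is transferred combinatorially (vertex-figure degrees); global injectivity needs no
smallness at all beyond local rigidity (covering-space argument with the δ floor).
Disproof used: none on file. Negatives honoured: no count-only inference; every configuration
quantified over is `δ`-separated.
-/

noncomputable section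

namespace Summit.AtomisticToContinuum.Crystallization.Cruxes.RobustBarlowTemplate.Birth

open Literature.MathematicalPhysics.StatisticalMechanics Literature.Geometry.DiscreteGeometry
open Summit.AtomisticToContinuum.Crystallization.Theorems.HullExactificationCascadeRobustBarlowTemplate

/-- Euclidean `3`-space. -/
local notation "E3" => EuclideanSpace ℝ (Fin 3)

/-! ### Vocabulary
The predicates `nnd`, `shell`, `Good`, `Sep`, `Recip`, `idealStacking`, `LocSim`, `ShellClosed` are the
LANDED definitions of `Theorems/HullExactificationCascadeRobustBarlowTemplateDefs.lean` (p146590) and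
`TransportSystem`, `IsShellCovering` (with `IsZChart`) those of
`Theorems/HullExactificationCascadeRobustBarlowTemplateTransportDefs.lean` (p151073), namespace
`…Theorems.HullExactificationCascadeRobustBarlowTemplate` (opened above); the crux predicates unfold
definitionally to the crux text. -/

/-! ### Registered stubs -/

/-- STUB 1 (M) — reciprocity of shells in an everywhere-good separated configuration
(covering radius `45° < 60°` of both patterns). -/
theorem stub_reciprocity :
    ∀ δ : ℝ, 0 < δ → ∀ S : Set E3, Sep δ S → (∀ y ∈ S, Good S y) → Recip S :=
  -- LANDED: p149678 (Theorems/HullExactificationCascadeRobustBarlowTemplateStubReciprocity.lean)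
  Summit.AtomisticToContinuum.Crystallization.Theorems.HullExactificationCascadeRobustBarlowTemplate.stub_reciprocity

/-! #### The reshape of `stub_develop` (lead c3, cycle 1): four registered stubs, along the landed
architecture of the sibling crux 9227 `ShellsToBarlowChart` (charts → transport system → covering →
metric clause → injectivity); the local front end `develop_charts` is LANDED (p148354). -/

/-- STUB 2a (XL) — THE TRANSPORT SYSTEM of an everywhere-good separated nonempty configuration with
reciprocal shells (geometric half of the development; port at tolerance `1/20` with scale-relative
bonds of 9227's `stub_transportSystem`: integer charts `IsZChart` from `develop_charts`, the `1/20`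
transfer lemma — metric on the spectrum `{18,36,54}` of `2K₂` edges, combinatorial (vertex-figure
degrees) on `P₃+K₁` edges —, then the frame transports `I, J, V` with parity, Hales's dichotomy). -/
theorem develop_transport :
    ∀ δ : ℝ, 0 < δ → ∀ S : Set E3, S.Nonempty → Sep δ S → (∀ y ∈ S, Good S y) → Recip S →
      TransportSystem S :=
  -- LANDED: p165017 (Theorems/HullExactificationCascadeRobustBarlowTemplateDevelopTransport.lean)
  Summit.AtomisticToContinuum.Crystallization.Theorems.HullExactificationCascadeRobustBarlowTemplate.develop_transport

/-- STUB 2b (M) — DEVELOP THE COVERING from a transport system (algebraic half; port of 9227's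
`stub_developCovering`: `s k := par (V^k f₀)`, `Ψ (barlowPos 1 √(2/3) s k i j) := pt (V^k (J^j (I^i f₀)))`,
star-bijective and link-faithful by `touching_iff_exists_linkOffsets` / `dist_relPos_eq_iff_linkAdj`). -/
theorem develop_covering :
    ∀ S : Set E3, TransportSystem S → ∃ s : ℤ → ℤ, IsHaggSeq s ∧ ∃ Ψ : E3 → E3, IsShellCovering S s Ψ :=
  -- LANDED: p152042 (Theorems/HullExactificationCascadeRobustBarlowTemplateDevelopCovering.lean)
  Summit.AtomisticToContinuum.Crystallization.Theorems.HullExactificationCascadeRobustBarlowTemplate.develop_covering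

/-- STUB 2c (M) — THE METRIC CLAUSE: a shell covering of an everywhere-good configuration is
`1/20`-close to a similarity on every unit cluster (the unit cluster of `p` is `p` and its twelve
contacts; the star bijection `contacts p → shell S (Ψ p)` composed with the chart at `Ψ p` is a
contact-graph isomorphism between exact kissing patterns, hence a linear isometry — pattern
rigidity —, and the chart estimate is `LocSim` with `l = nnd S (Ψ p)`). -/
theorem develop_locsim :
    ∀ δ : ℝ, 0 < δ → ∀ S : Set E3, Sep δ S → (∀ y ∈ S, Good S y) → Recip S →
      ∀ (s : ℤ → ℤ) (Ψ : E3 → E3), IsHaggSeq s → IsShellCovering S s Ψ → LocSim s Ψ :=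
  -- LANDED: p152179 (Theorems/HullExactificationCascadeRobustBarlowTemplateDevelopLocSim.lean)
  Summit.AtomisticToContinuum.Crystallization.Theorems.HullExactificationCascadeRobustBarlowTemplate.develop_locsim

/-- STUB 2d (XL, the genuinely new global content) — INJECTIVITY: a locally similar shell covering
of an everywhere-good `δ`-SEPARATED configuration is injective.  The scale of `S` is unbounded (only
the floor `δ ≤ nnd`), so 9227's growth descent does not apply; plan: the piecewise-affine extension
of `Ψ` to `ℝ³` is continuous, open, injective on every unit ball and covers the concentric
`cδ`-balls (co-Lipschitz thanks to the floor `δ`), hence a covering map of `ℝ³`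
(`isCoveringMap_of_uniform`), hence bijective (monodromy on simply connected `ℝ³`). -/
theorem develop_injective :
    ∀ δ : ℝ, 0 < δ → ∀ S : Set E3, Sep δ S → (∀ y ∈ S, Good S y) → Recip S →
      ∀ (s : ℤ → ℤ) (Ψ : E3 → E3), IsHaggSeq s → IsShellCovering S s Ψ → LocSim s Ψ →
        Set.InjOn Ψ (idealStacking s) :=
  -- LANDED: p162600 (Theorems/HullExactificationCascadeRobustBarlowTemplateDevelopInjective.lean)
  Summit.AtomisticToContinuum.Crystallization.Theorems.HullExactificationCascadeRobustBarlowTemplate.develop_injective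

/-- STUB 2 (derived, no `sorry` of its own) — robust layer propagation: an everywhere-good separated
nonempty configuration with reciprocal shells contains an injective, shell-closed, locally
`1/20`-similar copy of an ideal Barlow stacking of some Hägg sequence.  Composition of 2a–2d:
the transport system is developed into a shell covering `Ψ` (2a, 2b), which is locally similar
(2c) and injective (2d); `MapsTo` is part of the covering and shell-closedness is star-surjectivity. -/
theorem stub_develop :
    ∀ δ : ℝ, 0 < δ → ∀ S : Set E3, S.Nonempty → Sep δ S → (∀ y ∈ S, Good S y) → Recip S →
      ∃ s : ℤ → ℤ, IsHaggSeq s ∧ ∃ Φ : E3 → E3, Set.MapsTo Φ (idealStacking s) S ∧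
        Set.InjOn Φ (idealStacking s) ∧ LocSim s Φ ∧ ShellClosed S s Φ := by
  intro δ hδ S hne hsep hgood hR
  obtain ⟨s, hs, Ψ, hcov⟩ := develop_covering S (develop_transport δ hδ S hne hsep hgood hR)
  have hloc : LocSim s Ψ := develop_locsim δ hδ S hsep hgood hR s Ψ hs hcov
  have hinj : Set.InjOn Ψ (idealStacking s) := develop_injective δ hδ S hsep hgood hR s Ψ hs hcov hloc
  refine ⟨s, hs, Ψ, hcov.1, hinj, hloc, ?_⟩
  intro p hp z hz
  obtain ⟨q, hq, rfl⟩ := (hcov.2.1 p hp).surjOn hz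
  exact ⟨q, hq.1, rfl⟩

/-- STUB 3 (M) — no room for foreign points: a nonempty shell-closed subset of an everywhere-good
separated configuration with reciprocal shells is the whole configuration (descent of the
distance to `M` by `0.18 δ` per step, floor `1.3 δ`). -/
theorem stub_exhaust :
    ∀ δ : ℝ, 0 < δ → ∀ S : Set E3, Sep δ S → (∀ y ∈ S, Good S y) → Recip S →
      ∀ M : Set E3, M ⊆ S → M.Nonempty → (∀ x ∈ M, shell S x ⊆ M) → S ⊆ M :=
  -- LANDED: p149628 (Theorems/HullExactificationCascadeRobustBarlowTemplateStubExhaust.lean)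
  Summit.AtomisticToContinuum.Crystallization.Theorems.HullExactificationCascadeRobustBarlowTemplate.stub_exhaust

/-! ### The composition (kernel-checked, no `sorry`): stubs 1–3 ⟹ the crux -/

/-- COMPOSITION WITH EXPLICIT HYPOTHESES (`stub₁-sig → stub₂-sig → stub₃-sig → crux body`; the
conclusion is the crux's statement written with the named predicates of this file, to which the
route decl unfolds definitionally, so that `RobustBarlowTemplate_of` below is the ONLY theorem of
the file whose head is the crux name — the `ledger skeleton check` shape). Pure logic: reciprocity,
then the developed template `Φ`, then exhaustion applied to `M = Φ '' stacking` gives surjectivity,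
hence `Set.BijOn`. -/
theorem composition
    (h_recip : ∀ δ : ℝ, 0 < δ → ∀ S : Set E3, Sep δ S → (∀ y ∈ S, Good S y) → Recip S)
    (h_develop : ∀ δ : ℝ, 0 < δ → ∀ S : Set E3, S.Nonempty → Sep δ S → (∀ y ∈ S, Good S y) →
      Recip S → ∃ s : ℤ → ℤ, IsHaggSeq s ∧ ∃ Φ : E3 → E3, Set.MapsTo Φ (idealStacking s) S ∧
        Set.InjOn Φ (idealStacking s) ∧ LocSim s Φ ∧ ShellClosed S s Φ)
    (h_exhaust : ∀ δ : ℝ, 0 < δ → ∀ S : Set E3, Sep δ S → (∀ y ∈ S, Good S y) → Recip S →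
      ∀ M : Set E3, M ⊆ S → M.Nonempty → (∀ x ∈ M, shell S x ⊆ M) → S ⊆ M) :
    ∀ δ : ℝ, 0 < δ → ∀ S : Set E3, S.Nonempty → Sep δ S → (∀ y ∈ S, Good S y) →
      ∃ s : ℤ → ℤ, IsHaggSeq s ∧ ∃ Φ : E3 → E3, Set.BijOn Φ (idealStacking s) S ∧ LocSim s Φ := by
  intro δ hδ S hne hsep hgood
  -- movement 1: reciprocity of shells
  have hR : Recip S := h_recip δ hδ S hsep hgood
  -- movement 2: develop the template inside `S`
  obtain ⟨s, hs, Φ, hmaps, hinj, hloc, hclosed⟩ := h_develop δ hδ S hne hsep hgood hR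
  -- movement 3: the template is a nonempty shell-closed subset, hence exhausts `S`
  have hMsub : Φ '' idealStacking s ⊆ S := hmaps.image_subset
  have hMne : (Φ '' idealStacking s).Nonempty :=
    ⟨Φ (barlowPos 1 (Real.sqrt (2 / 3)) s 0 0 0),
      Set.mem_image_of_mem Φ (barlowPos_mem (a := 1) (h := Real.sqrt (2 / 3)) (s := s) 0 0 0)⟩
  have hMclosed : ∀ x ∈ Φ '' idealStacking s, shell S x ⊆ Φ '' idealStacking s := by
    rintro _ ⟨p, hp, rfl⟩
    exact hclosed p hp
  have hsurj : Set.SurjOn Φ (idealStacking s) S :=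
    h_exhaust δ hδ S hsep hgood hR (Φ '' idealStacking s) hMsub hMne hMclosed
  exact ⟨s, hs, Φ, ⟨hmaps, hinj, hsurj⟩, hloc⟩

/-- THE SKELETON THEOREM: the crux
`Summit.AtomisticToContinuum.Crystallization.Theses.HullExactificationCascade.RobustBarlowTemplate`
concluded BY NAME (type literally the route decl) from the three DECLARED stubs through the
sorry-free `composition`; `sorry` lives only inside `stub_*`. The crux's inlined `let d / let T`
hypothesis is `Good` and its conclusion is `Set.BijOn … ∧ LocSim …` by definitional unfolding. -/
theorem RobustBarlowTemplate_of :
    Summit.AtomisticToContinuum.Crystallization.Theses.HullExactificationCascade.RobustBarlowTemplate := by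
  intro δ hδ S hne hsep hgood
  obtain ⟨s, hs, Φ, hbij, hloc⟩ :=
    composition stub_reciprocity stub_develop stub_exhaust δ hδ S hne hsep (fun y hy => hgood y hy)
  exact ⟨s, hs, Φ, hbij, hloc⟩

end Summit.AtomisticToContinuum.Crystallization.Cruxes.RobustBarlowTemplate.Birth

end
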